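import Summits.HodgeConjecture.HodgeConjecture.Theorems.EndoscopicMiddleDegreeAlgebraicOrEnvelopedOfAlgebraicKernel
import Summits.HodgeConjecture.HodgeConjecture.Theorems.EndoscopicMiddleDegreeAlgebraicOrEnvelopedStubHeckeGraphAlgebraic
import Summits.HodgeConjecture.HodgeConjecture.Theorems.EndoscopicMiddleDegreeOrthogonalEnvelopedOfCoreVanishing
import Literature.AlgebraicGeometry.HodgeTheory.HardLefschetzHodgeRiemannHolds
import Literature.AlgebraicGeometry.HodgeTheory.MotivatedClassesProofs
import Literature.AlgebraicGeometry.Motives.ComplexPointsOrientation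
import Literature.AlgebraicTopology.SingularHomology.PoincareDualityProofs
import Literature.NumberTheory.Transcendental.DeRhamTheoremMultiplicative
import HarnessLib

/-!
# Calibration of the bet of line `core-splitting-ladder` (crux `AlgebraicOrEnveloped`, stmt-HodgeConjecture-14943):
# HC on Hecke cores sits between the route's target and the sibling crux's bet

The registered skeleton of line `core-splitting-ladder` (`Cruxes/AlgebraicOrEnveloped/Lines/core_splitting_ladder.lean`)
closes the crux modulo Grothendieck's coniveau remark, `CupProductAlgebraic` and ONE bet, **CoreHodgeClassesAlgebraic**
(the Hodge conjecture for the rational Hodge classes `ε e` of the impure, un-killed ℚ-blocks `ε` — the CORES — of the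
Hecke algebra on `H²ⁿ` of a compact ball quotient of dimension `2n = 2(m+1)`, `m ∈ {1,2}`; durable form
`Theorems/EndoscopicMiddleDegreeAlgebraicOrEnvelopedOfCoreHodgeClassesAlgebraic`). This file places the bet,
kernel-checked, between the two neighbouring statements of the route (texts spelled out verbatim, no definition):

* `coreHodgeClassesAlgebraic_of_middleDegreeStep` — the route's TARGET `MiddleDegreeStep` (middle-degree HC on the
  sector, stmt-HodgeConjecture-14346) implies the bet outright (`ε e` is rational and `(n,n)`): the bet is HC-implied,
  hence unrefutable short of `¬HC` (crux Disproof F1);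
* `coreHodgeClassesAlgebraic_of_coreVanishing` — the sibling crux's registered bet `stub_coreVanishing`
  (stmt-HodgeConjecture-14300, line `purity-sorted-hecke-envelope`: cores kill the rational `(n,n)`-classes
  cup-orthogonal to the theta world `TW(D)`) implies the bet GRANTED Grothendieck's coniveau remark and
  `CupProductAlgebraic`: split `e ∈ Alg ⊔ span {e' rational Hodge ⊥ Alg}` (landed `Theorems.stub_algebraicKernelSplit`,
  p99326, fed with the theorems `hardLefschetz_hodgeRiemann_holds`, `exists_deRhamIsoFamily_holds`); the Hecke algebra
  preserves `Alg` (`heckeAlgebra_mem_algebraicClasses`: `T = P_γ`, `γ` algebraic, p112869 + p91059, and `P_γ (Alg) ⊆ Alg`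
  by `CupProductAlgebraic`); `ε e' = 0` because `⊥ Alg ⟹ ⊥ TW(D)` (`thetaWorld_le_algebraicClasses`). Without the
  coniveau remark this implication fails in the bookkeeping shadow (an `Alg` spanned by a rational NON-Hodge class
  makes the sibling bet vacuous), so the pure case "algebraic ⟹ `(n,n)`" is load-bearing here exactly as in the split;
* `algebraicOrEnveloped_of_coreVanishing` — hence (or directly: p106212 ∘ p115730) the crux of THIS line follows from
  the SAME three hypotheses as the sibling crux `OrthogonalEnveloped` does in
  `Theorems.EndoscopicMiddleDegreeOrthogonalEnvelopedOfCoreVanishing.orthogonalEnveloped_of_coreVanishing`: one item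
  (the sibling's bet) closes both cruxes conditionally; the bet of this line is the weaker, HC-implied residue.

Not here: the bet itself (HC-strength), any new definition, any restatement of the crux or of `OrthogonalEnveloped`.

References: Bergeron–Millson–Moeglin arXiv:1306.1515 Part 2 §1.9, Thm. 61; Grothendieck, Topology 8 (1969) p. 300;
Voisin, Hodge Theory I Thm. 6.32, §7.1.2; Hodge Theory II Prop. 9.20; Kudla–Millson IHES 71 (1990).
-/

noncomputable section

-- The namespace `Summit.<P>.<Sub>.Theorems.…` repeats `HodgeConjecture` (single-conjunct summit; tree-wide pattern).
set_option linter.dupNamespace false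

namespace Summit.HodgeConjecture.HodgeConjecture.Theorems.EndoscopicMiddleDegreeAlgebraicOrEnvelopedCoreHodgeClassesAlgebraicCalibration

open CategoryTheory MonoidalCategory CartesianMonoidalCategory
open Literature.AlgebraicGeometry.Motives (SchemeOver ComplexPoints IsSmoothProjective)
open Literature.AlgebraicGeometry.HodgeTheory
open Literature.AlgebraicGeometry.ShimuraVarieties
open Literature.AlgebraicTopology.SingularHomology
open Summit.HodgeConjecture.HodgeConjecture.Theses.EndoscopicMiddleDegree
  (MiddleDegreeStep CupProductAlgebraic AlgebraicOrEnveloped)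
open Summit.HodgeConjecture.HodgeConjecture.Cruxes.MiddleThetaSpan.ConjugateDimensionSieve
  (IsCentralIdempotent IsPrimitiveCentralIdempotent)
open Summit.HodgeConjecture.HodgeConjecture.Cruxes.OrthogonalEnveloped.ImpureBarrenEnvelope (stub_corrAlgebra)
open Summit.HodgeConjecture.HodgeConjecture.Theorems.EndoscopicMiddleDegreeOrthogonalEnvelopedOfCoreVanishing
  (cupTriple_of_cupProductAlgebraic orthogonalEnveloped_of_coreVanishing)

/-! ## The bet from the route's target -/

/-- **`MiddleDegreeStep ⟹ CoreHodgeClassesAlgebraic`**: the bet of line `core-splitting-ladder` (conclusion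
`ε e ∈ algebraicClasses X (m+1)` for every core `ε` and rational `(n,n)`-class `e`; text verbatim = the registered
`stub_coreHodgeClassesAlgebraic`) follows from the route's target, since `ε e` is rational (`h4`) and of type `(n,n)`
(`hεH`). Calibration: the bet is HC-implied (crux Disproof F1). [cite: BergeronMillsonMoeglin2016Balls, Part 2 §1.9] -/
theorem coreHodgeClassesAlgebraic_of_middleDegreeStep (h : MiddleDegreeStep) :
    ∀ (m : ℕ) (X : SchemeOver ℂ) (D : UnitaryBallQuotientDatum (2 * (m + 1)) X), 1 ≤ m → m ≤ 2 →
      (∀ a : complexBetti X (2 * m), IsRationalClass a →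
        IsOfHodgeType (2 * (m + 1)) X (2 * m) m m a → a ∈ algebraicClasses X m) →
      ∀ ε : Module.End ℂ (complexBetti X (2 * (m + 1))),
        ε ∈ Algebra.adjoin ℂ (Set.range (D.heckeCorrespondenceAction (2 * (m + 1)))) →
        ε * ε = ε →
        (∀ T ∈ Algebra.adjoin ℂ (Set.range (D.heckeCorrespondenceAction (2 * (m + 1)))),
          T * ε = ε * T) →
        (∀ β, IsRationalClass β → IsRationalClass (ε β)) →
        (∀ (p q : ℕ) (x : complexBetti X (2 * (m + 1))), IsOfHodgeType (2 * (m + 1)) X (2 * (m + 1)) p q x →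
          IsOfHodgeType (2 * (m + 1)) X (2 * (m + 1)) p q (ε x)) →
        (∀ f ∈ Algebra.adjoin ℂ (Set.range (D.heckeCorrespondenceAction (2 * (m + 1)))),
          f * f = f →
          (∀ T ∈ Algebra.adjoin ℂ (Set.range (D.heckeCorrespondenceAction (2 * (m + 1)))),
            T * f = f * T) →
          (∀ β, IsRationalClass β → IsRationalClass (f β)) → f * ε = 0 ∨ f * ε = ε) →
        (∃ β, ¬ IsOfHodgeType (2 * (m + 1)) X (2 * (m + 1)) (m + 1) (m + 1) (ε β)) →
        (∃ z : Module.End ℂ (complexBetti X (2 * (m + 1))),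
          IsPrimitiveCentralIdempotent
              (Algebra.adjoin ℂ (Set.range (D.heckeCorrespondenceAction (2 * (m + 1))))) z ∧
            z * ε = z ∧
              ∀ σ : ℂ ≃+* ℂ, ∃ c : complexBetti X (2 * (m + 1)),
                IsOfHodgeType (2 * (m + 1)) X (2 * (m + 1)) (m + 1) (m + 1) (conjEnd σ z c) ∧
                  conjEnd σ z c ≠ 0) →
        ∀ e : complexBetti X (2 * (m + 1)), IsRationalClass e →
          IsOfHodgeType (2 * (m + 1)) X (2 * (m + 1)) (m + 1) (m + 1) e →
          ε e ∈ algebraicClasses X (m + 1) := by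
  intro m X D hm1 hm2 hlow ε _ _ _ h4 hεH _ _ _ e he heH
  exact h m X hm1 hm2 ⟨D⟩ hlow (ε e) (h4 e he) (hεH _ _ e heH)

/-! ## The bet from the sibling crux's bet, granted the coniveau remark and `CupProductAlgebraic` -/

/-- **The theta world `TW(D)` consists of algebraic classes** (given HC in degree `2m` on `X` and `CupProductAlgebraic`):
special cycle classes and cycles-on-special-cycles are supported in codimension `≥ m+1`
(`classesSupportedOn_le_supportedClasses` with the datum's closedness / codimension fields), the Lefschetz summand `a ∪ d`
is algebraic by `hlow` and `CupProductAlgebraic` (the argument of the landed `Theorems.algebraicKernelEnveloped_of_orthogonalEnveloped`).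
[cite: GrothendieckTopology1969, p. 300] [cite: KudlaMillson1990, Thm. 2.1] -/
theorem thetaWorld_le_algebraicClasses (hcup : CupProductAlgebraic) {m : ℕ} {X : SchemeOver ℂ}
    (D : UnitaryBallQuotientDatum (2 * (m + 1)) X)
    (hlow : ∀ a : complexBetti X (2 * m), IsRationalClass a →
      IsOfHodgeType (2 * (m + 1)) X (2 * m) m m a → a ∈ algebraicClasses X m) :
    ((⨆ (W : Submodule D.E (Fin (2 * (m + 1) + 1) → D.E))
      (_ : IsTotallyPositive (conjRingHom D.E) D.H W) (_ : Module.finrank D.E W = m + 1),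
      classesSupportedOn X (D.specialSubvariety W) (2 * (m + 1))) ⊔
    (⨆ (W : Submodule D.E (Fin (2 * (m + 1) + 1) → D.E))
      (_ : IsTotallyPositive (conjRingHom D.E) D.H W) (_ : Module.finrank D.E W = m)
      (Z : Set X.left) (_ : IsClosed Z) (_ : Z ⊆ D.specialSubvariety W)
      (_ : ∀ z ∈ Z, ((m + 1 : ℕ) : ℕ∞) ≤ Order.coheight z),
      classesSupportedOn X Z (2 * (m + 1))) ⊔
    Submodule.span ℂ {z : complexBetti X (2 * (m + 1)) |
      ∃ a : complexBetti X (2 * m), IsRationalClass a ∧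
        IsOfHodgeType (2 * (m + 1)) X (2 * m) m m a ∧ ∃ d ∈ algebraicClasses X 1,
          z = cupProduct (two_mul_add_two_mul m 1) a d}) ≤ algebraicClasses X (m + 1) := by
  have hX : IsSmoothProjective (2 * (m + 1)) X := D.isSmoothProjective
  refine sup_le (sup_le ?_ ?_) ?_
  · refine iSup_le fun W ↦ iSup_le fun hW ↦ iSup_le fun hk ↦
      classesSupportedOn_le_supportedClasses (D.isClosed_specialSubvariety W hW) (fun z hz ↦ ?_) _
    have := D.le_coheight_of_mem_specialSubvariety W hW z hz
    rw [hk] at this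
    exact_mod_cast this
  · exact iSup_le fun _ ↦ iSup_le fun _ ↦ iSup_le fun _ ↦ iSup_le fun _ ↦ iSup_le fun hZ ↦
      iSup_le fun _ ↦ iSup_le fun hk ↦ classesSupportedOn_le_supportedClasses hZ hk _
  · refine Submodule.span_le.2 ?_
    rintro z ⟨a, ha, haH, d, hd, rfl⟩
    exact hcup hX m 1 a d (hlow a ha haH) hd

/-- **The Hecke algebra preserves `algebraicClasses X n`** (given `CupProductAlgebraic`): every `a ∈ 𝓗` is `P_γ` for an
algebraic `γ` (landed `Theorems.CoreSplittingLadder.stub_heckeGraphAlgebraic` p112869 + `stub_corrAlgebra` p91059, at the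
complex orientation family, which has Poincaré duality), and `P_γ` preserves algebraic classes
(`corrClassAction_mem_algebraicClasses_of_cupProduct` through `corrAction_eq_corrClassAction`).
[cite: VoisinHodgeII2003, §9.2.4 Prop. 9.20 and Prop. 9.21] [cite: BergeronMillsonMoeglin2016Balls, Part 2 §1.8 and Thm. 61] -/
theorem heckeAlgebra_mem_algebraicClasses (hcup : CupProductAlgebraic) {m : ℕ} {X : SchemeOver ℂ}
    (D : UnitaryBallQuotientDatum (2 * (m + 1)) X) (hm1 : 1 ≤ m) (hm2 : m ≤ 2)
    {a : Module.End ℂ (complexBetti X (2 * (m + 1)))}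
    (ha : a ∈ Algebra.adjoin ℂ (Set.range (D.heckeCorrespondenceAction (2 * (m + 1)))))
    {c : complexBetti X (2 * (m + 1))} (hc : c ∈ algebraicClasses X (m + 1)) :
    a c ∈ algebraicClasses X (m + 1) := by
  have hX : IsSmoothProjective (2 * (m + 1)) X := D.isSmoothProjective
  obtain ⟨μ, hμ⟩ : ∃ μ : OrientationFamily, μ.HasPoincareDuality :=
    ⟨fun _ _ h ↦ Classical.choice
        (Literature.AlgebraicGeometry.Motives.ComplexPoints.isOrientableOver ℂ h),
      OrientationFamily.hasPoincareDuality_of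
        (fun ν _ _ h ↦ Literature.AlgebraicTopology.SingularHomology.poincare_duality ν h) _⟩
  obtain ⟨⟨δ, hδ, hδid⟩, hcomp⟩ := stub_corrAlgebra μ hμ m X hX (cupTriple_of_cupProductAlgebraic hcup m X hX)
  let S : Subalgebra ℂ (Module.End ℂ (complexBetti X (2 * (m + 1)))) :=
    { carrier := {T | ∃ γ ∈ algebraicClasses (X ⊗ X) (2 * (m + 1)),
        corrAction μ hX hX (rfl : 2 * (m + 1) + 2 * (2 * (m + 1)) = 2 * (m + 1) + 2 * (2 * (m + 1))) γ = T}
      mul_mem' := by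
        rintro _ _ ⟨γ, hγ, rfl⟩ ⟨γ', hγ', rfl⟩
        exact hcomp γ hγ γ' hγ'
      one_mem' := ⟨δ, hδ, hδid⟩
      add_mem' := by
        rintro _ _ ⟨γ, hγ, rfl⟩ ⟨γ', hγ', rfl⟩
        exact ⟨γ + γ', add_mem hγ hγ', map_add _ _ _⟩
      zero_mem' := ⟨0, zero_mem _, map_zero _⟩
      algebraMap_mem' := fun c ↦ ⟨c • δ, Submodule.smul_mem _ c hδ, by
        rw [map_smul, hδid, Algebra.algebraMap_eq_smul_one]; rfl⟩ }
  have hle : Algebra.adjoin ℂ (Set.range (D.heckeCorrespondenceAction (2 * (m + 1)))) ≤ S := by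
    refine Algebra.adjoin_le ?_
    rintro _ ⟨g, rfl⟩
    exact Theorems.CoreSplittingLadder.stub_heckeGraphAlgebraic μ hμ m X D hm1 hm2 g
  obtain ⟨γ, hγ, hP⟩ := hle ha
  rw [← hP, corrAction_eq_corrClassAction μ hX hX _ (q := 2 * (m + 1)) (by ring)]
  exact corrClassAction_mem_algebraicClasses_of_cupProduct hX hX _ _ (hμ hX) (p := m + 1) (e := 2 * (m + 1))
    (q := m + 1) (k := 2 * (m + 1)) _ _
    (fun x y hx hy ↦ hcup (IsSmoothProjective.tensor_holds hX hX) (m + 1) (2 * (m + 1)) x y hx hy) hγ hc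

/-- **The sibling's bet ⟹ this line's bet, GRANTED Grothendieck's coniveau remark and `CupProductAlgebraic`**:
`stub_coreVanishing` of crux stmt-HodgeConjecture-14300 (third hypothesis, text verbatim = the registered stub of line
`purity-sorted-hecke-envelope` = the third hypothesis of the landed `orthogonalEnveloped_of_coreVanishing`) implies
CoreHodgeClassesAlgebraic (conclusion, text verbatim = the bet of line `core-splitting-ladder`): split a rational Hodge
`(n,n)`-class `e ∈ Alg ⊔ span {e' rational Hodge ⊥ Alg}` (landed `Theorems.stub_algebraicKernelSplit` p99326 with the
theorems `hardLefschetz_hodgeRiemann_holds`, `exists_deRhamIsoFamily_holds`; consumes the coniveau remark), map `Alg` into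
`Alg` (`heckeAlgebra_mem_algebraicClasses`), and kill each `e'` by the sibling's bet (`⊥ Alg ⟹ ⊥ TW(D)`,
`thetaWorld_le_algebraicClasses`). The Hodge-type hypotheses on `ε` are not used.
[cite: BergeronMillsonMoeglin2016Balls, Part 2 §1.9 and Thm. 61] [cite: VoisinHodgeI2002, Thm. 6.32 and §7.1.2] -/
theorem coreHodgeClassesAlgebraic_of_coreVanishing (hG : Grothendieck1969_supportedClasses_le_hodgeConiveau)
    (hcup : CupProductAlgebraic)
    (hCV : ∀ (m : ℕ) (X : SchemeOver ℂ) (D : UnitaryBallQuotientDatum (2 * (m + 1)) X), 1 ≤ m → m ≤ 2 →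
      ∀ ε : Module.End ℂ (complexBetti X (2 * (m + 1))),
        ε ∈ Algebra.adjoin ℂ (Set.range (D.heckeCorrespondenceAction (2 * (m + 1)))) →
        ε * ε = ε →
        (∀ T ∈ Algebra.adjoin ℂ (Set.range (D.heckeCorrespondenceAction (2 * (m + 1)))),
          T * ε = ε * T) →
        (∀ β, IsRationalClass β → IsRationalClass (ε β)) →
        (∀ f ∈ Algebra.adjoin ℂ (Set.range (D.heckeCorrespondenceAction (2 * (m + 1)))),
          f * f = f →
          (∀ T ∈ Algebra.adjoin ℂ (Set.range (D.heckeCorrespondenceAction (2 * (m + 1)))),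
            T * f = f * T) →
          (∀ β, IsRationalClass β → IsRationalClass (f β)) → f * ε = 0 ∨ f * ε = ε) →
        (∃ β, ¬ IsOfHodgeType (2 * (m + 1)) X (2 * (m + 1)) (m + 1) (m + 1) (ε β)) →
        (∃ z : Module.End ℂ (complexBetti X (2 * (m + 1))),
          IsPrimitiveCentralIdempotent
              (Algebra.adjoin ℂ (Set.range (D.heckeCorrespondenceAction (2 * (m + 1))))) z ∧
            z * ε = z ∧
              ∀ σ : ℂ ≃+* ℂ, ∃ c : complexBetti X (2 * (m + 1)),
                IsOfHodgeType (2 * (m + 1)) X (2 * (m + 1)) (m + 1) (m + 1) (conjEnd σ z c) ∧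
                  conjEnd σ z c ≠ 0) →
        ∀ e : complexBetti X (2 * (m + 1)), IsRationalClass e →
          IsOfHodgeType (2 * (m + 1)) X (2 * (m + 1)) (m + 1) (m + 1) e →
          (∀ x ∈ ((⨆ (W : Submodule D.E (Fin (2 * (m + 1) + 1) → D.E))
              (_ : IsTotallyPositive (conjRingHom D.E) D.H W) (_ : Module.finrank D.E W = m + 1),
              classesSupportedOn X (D.specialSubvariety W) (2 * (m + 1))) ⊔
            (⨆ (W : Submodule D.E (Fin (2 * (m + 1) + 1) → D.E))
              (_ : IsTotallyPositive (conjRingHom D.E) D.H W) (_ : Module.finrank D.E W = m)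
              (Z : Set X.left) (_ : IsClosed Z) (_ : Z ⊆ D.specialSubvariety W)
              (_ : ∀ z ∈ Z, ((m + 1 : ℕ) : ℕ∞) ≤ Order.coheight z),
              classesSupportedOn X Z (2 * (m + 1))) ⊔
            Submodule.span ℂ {z : complexBetti X (2 * (m + 1)) |
              ∃ a : complexBetti X (2 * m), IsRationalClass a ∧
                IsOfHodgeType (2 * (m + 1)) X (2 * m) m m a ∧
                ∃ d ∈ algebraicClasses X 1,
                  z = cupProduct (two_mul_add_two_mul m 1) a d}),
            cupProduct (two_mul_add_two_mul (m + 1) (m + 1)) e x = 0) →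
          ε e = 0) :
    ∀ (m : ℕ) (X : SchemeOver ℂ) (D : UnitaryBallQuotientDatum (2 * (m + 1)) X), 1 ≤ m → m ≤ 2 →
      (∀ a : complexBetti X (2 * m), IsRationalClass a →
        IsOfHodgeType (2 * (m + 1)) X (2 * m) m m a → a ∈ algebraicClasses X m) →
      ∀ ε : Module.End ℂ (complexBetti X (2 * (m + 1))),
        ε ∈ Algebra.adjoin ℂ (Set.range (D.heckeCorrespondenceAction (2 * (m + 1)))) →
        ε * ε = ε →
        (∀ T ∈ Algebra.adjoin ℂ (Set.range (D.heckeCorrespondenceAction (2 * (m + 1)))),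
          T * ε = ε * T) →
        (∀ β, IsRationalClass β → IsRationalClass (ε β)) →
        (∀ (p q : ℕ) (x : complexBetti X (2 * (m + 1))), IsOfHodgeType (2 * (m + 1)) X (2 * (m + 1)) p q x →
          IsOfHodgeType (2 * (m + 1)) X (2 * (m + 1)) p q (ε x)) →
        (∀ f ∈ Algebra.adjoin ℂ (Set.range (D.heckeCorrespondenceAction (2 * (m + 1)))),
          f * f = f →
          (∀ T ∈ Algebra.adjoin ℂ (Set.range (D.heckeCorrespondenceAction (2 * (m + 1)))),
            T * f = f * T) →
          (∀ β, IsRationalClass β → IsRationalClass (f β)) → f * ε = 0 ∨ f * ε = ε) →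
        (∃ β, ¬ IsOfHodgeType (2 * (m + 1)) X (2 * (m + 1)) (m + 1) (m + 1) (ε β)) →
        (∃ z : Module.End ℂ (complexBetti X (2 * (m + 1))),
          IsPrimitiveCentralIdempotent
              (Algebra.adjoin ℂ (Set.range (D.heckeCorrespondenceAction (2 * (m + 1))))) z ∧
            z * ε = z ∧
              ∀ σ : ℂ ≃+* ℂ, ∃ c : complexBetti X (2 * (m + 1)),
                IsOfHodgeType (2 * (m + 1)) X (2 * (m + 1)) (m + 1) (m + 1) (conjEnd σ z c) ∧
                  conjEnd σ z c ≠ 0) →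
        ∀ e : complexBetti X (2 * (m + 1)), IsRationalClass e →
          IsOfHodgeType (2 * (m + 1)) X (2 * (m + 1)) (m + 1) (m + 1) e →
          ε e ∈ algebraicClasses X (m + 1) := by
  intro m X D hm1 hm2 hlow ε h1 h2 h3 h4 _ h5 himp hcore e he heH
  have hsplit := Theorems.stub_algebraicKernelSplit (fun _ _ ↦ hardLefschetz_hodgeRiemann_holds) hG
    (fun E _ _ _ ↦ Literature.NumberTheory.Transcendental.exists_deRhamIsoFamily_holds E)
    hcup m X D hm1 hm2 hlow e he heH
  have key : algebraicClasses X (m + 1) ⊔ Submodule.span ℂ {e : complexBetti X (2 * (m + 1)) |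
        IsRationalClass e ∧ IsOfHodgeType (2 * (m + 1)) X (2 * (m + 1)) (m + 1) (m + 1) e ∧
        ∀ x ∈ algebraicClasses X (m + 1),
          cupProduct (two_mul_add_two_mul (m + 1) (m + 1)) e x = 0} ≤
      (algebraicClasses X (m + 1)).comap ε := by
    refine sup_le (fun c hc ↦ heckeAlgebra_mem_algebraicClasses hcup D hm1 hm2 h1 hc) (Submodule.span_le.2 ?_)
    rintro e' ⟨he', he'H, horth'⟩
    change ε e' ∈ algebraicClasses X (m + 1)
    rw [hCV m X D hm1 hm2 ε h1 h2 h3 h4 h5 himp hcore e' he' he'H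
      fun x hx ↦ horth' x (thetaWorld_le_algebraicClasses hcup D hlow hx)]
    exact zero_mem _
  exact key hsplit

/-! ## The crux of this line from the sibling's bet -/

/-- **`AlgebraicOrEnveloped` GRANTED Grothendieck's coniveau remark, `CupProductAlgebraic` and the sibling crux's bet
`stub_coreVanishing` (stmt-HodgeConjecture-14300, text verbatim)** — the same three hypotheses from which
`orthogonalEnveloped_of_coreVanishing` (p115730) derives `OrthogonalEnveloped`; here composed with the landed glue
`Theorems.algebraicKernelEnveloped_of_orthogonalEnveloped` / `Theorems.algebraicOrEnveloped_of_algebraicKernelEnveloped`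
(p106212; Kähler package = the theorem `hardLefschetz_hodgeRiemann_holds`). One conjecture-grade item closes both cruxes.
[cite: BergeronMillsonMoeglin2016Balls, Part 2 §1.9 and Thm. 61] [cite: VoisinHodgeI2002, Thm. 6.32 and §7.1.2] -/
theorem algebraicOrEnveloped_of_coreVanishing :
    Grothendieck1969_supportedClasses_le_hodgeConiveau → CupProductAlgebraic →
    (∀ (m : ℕ) (X : SchemeOver ℂ) (D : UnitaryBallQuotientDatum (2 * (m + 1)) X), 1 ≤ m → m ≤ 2 →
      ∀ ε : Module.End ℂ (complexBetti X (2 * (m + 1))),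
        ε ∈ Algebra.adjoin ℂ (Set.range (D.heckeCorrespondenceAction (2 * (m + 1)))) →
        ε * ε = ε →
        (∀ T ∈ Algebra.adjoin ℂ (Set.range (D.heckeCorrespondenceAction (2 * (m + 1)))),
          T * ε = ε * T) →
        (∀ β, IsRationalClass β → IsRationalClass (ε β)) →
        (∀ f ∈ Algebra.adjoin ℂ (Set.range (D.heckeCorrespondenceAction (2 * (m + 1)))),
          f * f = f →
          (∀ T ∈ Algebra.adjoin ℂ (Set.range (D.heckeCorrespondenceAction (2 * (m + 1)))),
            T * f = f * T) →
          (∀ β, IsRationalClass β → IsRationalClass (f β)) → f * ε = 0 ∨ f * ε = ε) →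
        (∃ β, ¬ IsOfHodgeType (2 * (m + 1)) X (2 * (m + 1)) (m + 1) (m + 1) (ε β)) →
        (∃ z : Module.End ℂ (complexBetti X (2 * (m + 1))),
          IsPrimitiveCentralIdempotent
              (Algebra.adjoin ℂ (Set.range (D.heckeCorrespondenceAction (2 * (m + 1))))) z ∧
            z * ε = z ∧
              ∀ σ : ℂ ≃+* ℂ, ∃ c : complexBetti X (2 * (m + 1)),
                IsOfHodgeType (2 * (m + 1)) X (2 * (m + 1)) (m + 1) (m + 1) (conjEnd σ z c) ∧
                  conjEnd σ z c ≠ 0) →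
        ∀ e : complexBetti X (2 * (m + 1)), IsRationalClass e →
          IsOfHodgeType (2 * (m + 1)) X (2 * (m + 1)) (m + 1) (m + 1) e →
          (∀ x ∈ ((⨆ (W : Submodule D.E (Fin (2 * (m + 1) + 1) → D.E))
              (_ : IsTotallyPositive (conjRingHom D.E) D.H W) (_ : Module.finrank D.E W = m + 1),
              classesSupportedOn X (D.specialSubvariety W) (2 * (m + 1))) ⊔
            (⨆ (W : Submodule D.E (Fin (2 * (m + 1) + 1) → D.E))
              (_ : IsTotallyPositive (conjRingHom D.E) D.H W) (_ : Module.finrank D.E W = m)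
              (Z : Set X.left) (_ : IsClosed Z) (_ : Z ⊆ D.specialSubvariety W)
              (_ : ∀ z ∈ Z, ((m + 1 : ℕ) : ℕ∞) ≤ Order.coheight z),
              classesSupportedOn X Z (2 * (m + 1))) ⊔
            Submodule.span ℂ {z : complexBetti X (2 * (m + 1)) |
              ∃ a : complexBetti X (2 * m), IsRationalClass a ∧
                IsOfHodgeType (2 * (m + 1)) X (2 * m) m m a ∧
                ∃ d ∈ algebraicClasses X 1,
                  z = cupProduct (two_mul_add_two_mul m 1) a d}),
            cupProduct (two_mul_add_two_mul (m + 1) (m + 1)) e x = 0) →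
          ε e = 0) →
    AlgebraicOrEnveloped :=
  fun hG hcup hCV ↦
    Theorems.algebraicOrEnveloped_of_algebraicKernelEnveloped (fun _ _ ↦ hardLefschetz_hodgeRiemann_holds) hG hcup
      (Theorems.algebraicKernelEnveloped_of_orthogonalEnveloped hcup (orthogonalEnveloped_of_coreVanishing hG hcup hCV))

end Summit.HodgeConjecture.HodgeConjecture.Theorems.EndoscopicMiddleDegreeAlgebraicOrEnvelopedCoreHodgeClassesAlgebraicCalibration

end
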